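import Summits.CriticalPhenomena.PercolationContinuityZ3.Theorems.PercNearOneGluingNoHeavyLowerTailSahiGridPatternCoCountProductN

/-!
# `NoHeavyLowerTail` (crux stmt-CriticalPhenomena-4575), Sahi programme P1: **CONJECTURE A HOLDS AT EVERY PRODUCT TEST PAIR** —
# for ALL blocks `S ⊆ [3]^n`, `V ⊆ [3]^k`, every boxed certificate `d_S` of `S`, every boxed `d_V` with condition (N) at ONE rectangle, the co-count
# product satisfies (N) at the test pairs `P = F × X`, `Q = G × Y` (every `n, k`)

Support file (Sahi cell, seat `prim-sahi-p1`, generation 41; `--supports stmt-CriticalPhenomena-4575`).  Pure proofs, no definitions, no `sorry`, standard axioms.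
Vocabulary of `…SahiGridPattern{,CellForm,SliceForm,DiagCert,DiagCertBlockAndT,DiagCertBlockAndTheta,CoCountProductN}` (`glue`, `ind`, `thetaVal`, `TotDist`,
`thirdPt`, `klCoef`, `freeOf`, `cellOf`).

THE MATHEMATICS.  CONJECTURE A (memo gen34 §2.5) says that the CO-COUNT PRODUCT `d'(glue ξ q) = 2^{n+k+1}1_S(ξ)1_V(q) − m_S(ξ)m_V(q)`
(`m_S = 2^{n+1}1_S − d_S`, `m_V = 2^{k+1}1_V − d_V`) of two diagonal certificates satisfies condition (N) for `S × V`: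
`Θ_{S×V}(P×Q) ≤ d'(P∩Q)` for all up-sets `P, Q ⊆ [3]^{n+k}`.  It is a theorem for top-cube `S` (`diagCert_coProduct_N_topCube`) and, for `S = x∨y`, at
co-monotone test pairs (`…CoCountProductNOrTwo`).  THIS FILE proves it — for ARBITRARY blocks `S, V` — at every PRODUCT test pair
`P = F × X := {glue ξ q : ξ ∈ F, q ∈ X}`, `Q = G × Y` (`F, G ⊆ [3]^n`, `X, Y ⊆ [3]^k` up-sets), a family containing the "crossed" pairs
`F = {x ≥ 1}`, `G = {y ≥ 1}` that are NOT co-monotone.  Only ONE instance of (N) for `V` is used — at the rectangle `(X, Y)` — together with (N) for `S`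
(at `(F,G)` and at `(⊤, F∩G)`), the two boxes, coefficientwise Harris in both blocks and Kleitman in the cell block:
**`diagCert_coProduct_N_of_product`**.  PROOF.  With `s = #(F∩G∩S)`, `c = d_S(F∩G)`, `ν = #(X∩Y∩V)`, `y = d_V(X∩Y)` and the pair counts
`N₁ = N(F∩S; G)`, `N₂ = N(G∩S; F)`, `L = Lat_S(F,G)` (so `Θ_S(F×G) = N₁ + N₂ − L`), `a = N(X∩V; Y)`, `a' = N(Y∩V; X)`, `m = M_V(X,Y)` (`Θ_V(X×Y) = a + a' − m`):
  `Θ_{S×V}(P×Q) = N₁·a + N₂·a' − L·m`  (`thetaVal_blockAnd`, the sums factor),   `d'(P∩Q) = 2^{n+k+1}sν − (2^{n+1}s − c)(2^{k+1}ν − y)`,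
and the difference is the sum of five nonnegative products
  `(2^{n+1}s − c)(y − Θ_V(X×Y)) + m(c − Θ_S(F×G)) + (a − m)(2^n s − N₁) + (a' − m)(2^n s − N₂) + (c − 2^n s)[(2^kν − a) + (2^kν − a')]`
(box of `d_S`; (N_V) at `(X,Y)`; Kleitman `m ≤ a, a'` and (N_S) at `(F,G)`; Harris `N₁, N₂ ≤ 2^n s`; `c ≥ 2^n s` from (N_S) at `(⊤,F∩G)` and Harris `a, a' ≤ 2^k ν`).
So at product test pairs the co-count product is certified by a ONE-ROW routing; seat memo FROM-prim-sahi-p1-gen41 shows that for general test pairs no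
routing with V-independent weights exists (k = 2), so the general case is of a different nature.  Nothing here asserts Conjecture A in general. [this work]
-/

namespace Summit.CriticalPhenomena.PercolationContinuityZ3.Theorems.SahiGridPattern

open Finset SahiGrid3
open scoped BigOperators

variable {n k : ℕ} {S : Finset (Pd n)} {V : Finset (Pd k)} {A : Finset (Pd (n + k))}

/-- Indicator of a product set `F × X` at a glued point. [this work] -/
theorem ind_glue_product {F : Finset (Pd n)} {X : Finset (Pd k)} {P : Finset (Pd (n + k))}
    (hP : ∀ ξ q, glue ξ q ∈ P ↔ (ξ ∈ F ∧ q ∈ X)) (ξ : Pd n) (q : Pd k) :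
    ind P (glue ξ q) = ind F ξ * ind X q := by
  unfold ind
  simp only [hP]
  by_cases h1 : ξ ∈ F <;> by_cases h2 : q ∈ X <;> simp [h1, h2]

/-- A four-fold sum of a product of an outer kernel and an inner kernel factors. [this work] -/
theorem sum4_mul_eq (f : Pd n → Pd n → ℤ) (g : Pd k → Pd k → ℤ) :
    (∑ ξ : Pd n, ∑ q : Pd k, ∑ η : Pd n, ∑ r : Pd k, f ξ η * g q r) = (∑ ξ : Pd n, ∑ η : Pd n, f ξ η) * (∑ q : Pd k, ∑ r : Pd k, g q r) := by
  rw [Finset.sum_mul]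
  refine Finset.sum_congr rfl fun ξ _ => ?_
  rw [Finset.sum_comm, Finset.sum_mul]
  refine Finset.sum_congr rfl fun η _ => ?_
  rw [Finset.mul_sum]
  refine Finset.sum_congr rfl fun q _ => ?_
  rw [Finset.mul_sum]

/-- A two-fold sum of a product of an outer and an inner function factors. [this work] -/
theorem sum2_mul_eq (f : Pd n → ℤ) (g : Pd k → ℤ) :
    (∑ ξ : Pd n, ∑ q : Pd k, f ξ * g q) = (∑ ξ : Pd n, f ξ) * (∑ q : Pd k, g q) := by
  rw [Finset.sum_mul]
  refine Finset.sum_congr rfl fun ξ _ => ?_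
  rw [Finset.mul_sum]

/-- Linear combination of two factorising two-fold sums. [this work] -/
theorem sum2_linComb (C : ℤ) (f f' : Pd n → ℤ) (g g' : Pd k → ℤ) :
    (∑ ξ : Pd n, ∑ q : Pd k, (C * (f ξ * g q) - f' ξ * g' q)) = C * ((∑ ξ : Pd n, f ξ) * (∑ q : Pd k, g q)) - (∑ ξ : Pd n, f' ξ) * (∑ q : Pd k, g' q) := by
  rw [← sum2_mul_eq, ← sum2_mul_eq, Finset.mul_sum, ← Finset.sum_sub_distrib]
  refine Finset.sum_congr rfl fun ξ _ => ?_
  rw [Finset.mul_sum, ← Finset.sum_sub_distrib]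

/-- `Θ_U(X × Y)` as the three indicator pair counts `a + a' − m`. [this work] -/
theorem theta_rect_eq_counts {d : ℕ} (U X Y : Finset (Pd d)) :
    (∑ q ∈ X, ∑ r ∈ Y, thetaVal U q r) =
      (∑ q : Pd d, ∑ r : Pd d, ind X q * ind Y r * (if TotDist q r = true then (1:ℤ) else 0) * ind U q)
      + (∑ q : Pd d, ∑ r : Pd d, ind X q * ind Y r * (if TotDist q r = true then (1:ℤ) else 0) * ind U r)
      - (∑ q : Pd d, ∑ r : Pd d, ind X q * ind Y r * (if TotDist q r = true then (1:ℤ) else 0) * ind U (thirdPt q r)) := by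
  rw [sum_mem_eq_sum_ind_mul X, ← Finset.sum_add_distrib, ← Finset.sum_sub_distrib]
  refine Finset.sum_congr rfl fun q _ => ?_
  rw [sum_mem_eq_sum_ind_mul Y, Finset.mul_sum, ← Finset.sum_add_distrib, ← Finset.sum_sub_distrib]
  refine Finset.sum_congr rfl fun r _ => ?_
  unfold thetaVal
  split_ifs <;> ring

/-- **Harris, pair-count form**: `#{(q,r) ∈ X × Y : q δ̸ r, q ∈ U} ≤ 2^d · #(X ∩ Y ∩ U)` for up-sets `U, X, Y`. [this work] -/
theorem pairCount_le_harris {d : ℕ} {U X Y : Finset (Pd d)} (hU : IsUpperSet (U : Set (Pd d))) (hX : IsUpperSet (X : Set (Pd d)))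
    (hY : IsUpperSet (Y : Set (Pd d))) :
    (∑ q : Pd d, ∑ r : Pd d, ind X q * ind Y r * (if TotDist q r = true then (1:ℤ) else 0) * ind U q) ≤
      2 ^ d * ∑ q : Pd d, ind X q * ind Y q * ind U q := by
  have h := sum_ind_totDist_le d (X ∩ U) Y (isUpperSet_inter_coe hX hU) hY
  have e1 : (∑ p : Pd d, ∑ q : Pd d, ind (X ∩ U) p * ind Y q * (if TotDist p q = true then (1:ℤ) else 0)) =
      ∑ q : Pd d, ∑ r : Pd d, ind X q * ind Y r * (if TotDist q r = true then (1:ℤ) else 0) * ind U q := by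
    refine Finset.sum_congr rfl fun q _ => Finset.sum_congr rfl fun r _ => ?_
    rw [ind_inter_eq_mul]; ring
  have e2 : (∑ p : Pd d, ind (X ∩ U) p * ind Y p) = ∑ q : Pd d, ind X q * ind Y q * ind U q := by
    refine Finset.sum_congr rfl fun q _ => ?_
    rw [ind_inter_eq_mul]; ring
  rw [e1, e2] at h
  exact h

/-- Harris for the second coordinate: `#{(q,r) ∈ X × Y : q δ̸ r, r ∈ U} ≤ 2^d · #(X ∩ Y ∩ U)`. [this work] -/
theorem pairCount_le_harris' {d : ℕ} {U X Y : Finset (Pd d)} (hU : IsUpperSet (U : Set (Pd d))) (hX : IsUpperSet (X : Set (Pd d)))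
    (hY : IsUpperSet (Y : Set (Pd d))) :
    (∑ q : Pd d, ∑ r : Pd d, ind X q * ind Y r * (if TotDist q r = true then (1:ℤ) else 0) * ind U r) ≤
      2 ^ d * ∑ q : Pd d, ind X q * ind Y q * ind U q := by
  have h := pairCount_le_harris (X := Y) (Y := X) hU hY hX
  have e1 : (∑ q : Pd d, ∑ r : Pd d, ind Y q * ind X r * (if TotDist q r = true then (1:ℤ) else 0) * ind U q) =
      ∑ q : Pd d, ∑ r : Pd d, ind X q * ind Y r * (if TotDist q r = true then (1:ℤ) else 0) * ind U r := by
    rw [Finset.sum_comm]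
    refine Finset.sum_congr rfl fun q _ => Finset.sum_congr rfl fun r _ => ?_
    rw [totDist_symm r q]; ring
  have e2 : (∑ q : Pd d, ind Y q * ind X q * ind U q) = ∑ q : Pd d, ind X q * ind Y q * ind U q :=
    Finset.sum_congr rfl fun q _ => by ring
  rw [e1, e2] at h
  exact h

/-- **Kleitman, pair-count form**: `M_U(X,Y) ≤ #{(q,r) ∈ X × Y : q δ̸ r, q ∈ U}` — in the cube around `r` the antipodal image of `Y ∩ U`… precisely
`Σ_{q∈X, r∈Y, q δ̸ r} (1_U(q) − 1_U(q̄r)) ≥ 0` (`sum_klCoef_ind_nonneg` summed over `r ∈ Y`). [this work] -/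
theorem latCount_le_pairCount {d : ℕ} {U X Y : Finset (Pd d)} (hU : IsUpperSet (U : Set (Pd d))) (hX : IsUpperSet (X : Set (Pd d))) :
    (∑ q : Pd d, ∑ r : Pd d, ind X q * ind Y r * (if TotDist q r = true then (1:ℤ) else 0) * ind U (thirdPt q r)) ≤
      ∑ q : Pd d, ∑ r : Pd d, ind X q * ind Y r * (if TotDist q r = true then (1:ℤ) else 0) * ind U q := by
  rw [← sub_nonneg, ← Finset.sum_sub_distrib]
  have e : (∑ q : Pd d, ((∑ r : Pd d, ind X q * ind Y r * (if TotDist q r = true then (1:ℤ) else 0) * ind U q) -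
      ∑ r : Pd d, ind X q * ind Y r * (if TotDist q r = true then (1:ℤ) else 0) * ind U (thirdPt q r))) =
      ∑ r : Pd d, ind Y r * ∑ q : Pd d, klCoef U r q * ind X q := by
    simp_rw [← Finset.sum_sub_distrib]
    rw [Finset.sum_comm]
    refine Finset.sum_congr rfl fun r _ => ?_
    rw [Finset.mul_sum]
    refine Finset.sum_congr rfl fun q _ => ?_
    unfold klCoef
    split_ifs <;> ring
  rw [e]
  refine Finset.sum_nonneg fun r _ => mul_nonneg ?_ (sum_klCoef_ind_nonneg hU hX r)
  unfold ind; split_ifs <;> norm_num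

/-- Kleitman for the second coordinate: `M_U(X,Y) ≤ #{(q,r) ∈ X × Y : q δ̸ r, r ∈ U}`. [this work] -/
theorem latCount_le_pairCount' {d : ℕ} {U X Y : Finset (Pd d)} (hU : IsUpperSet (U : Set (Pd d))) (hY : IsUpperSet (Y : Set (Pd d))) :
    (∑ q : Pd d, ∑ r : Pd d, ind X q * ind Y r * (if TotDist q r = true then (1:ℤ) else 0) * ind U (thirdPt q r)) ≤
      ∑ q : Pd d, ∑ r : Pd d, ind X q * ind Y r * (if TotDist q r = true then (1:ℤ) else 0) * ind U r := by
  have h := latCount_le_pairCount (X := Y) (Y := X) hU hY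
  have e1 : (∑ q : Pd d, ∑ r : Pd d, ind Y q * ind X r * (if TotDist q r = true then (1:ℤ) else 0) * ind U (thirdPt q r)) =
      ∑ q : Pd d, ∑ r : Pd d, ind X q * ind Y r * (if TotDist q r = true then (1:ℤ) else 0) * ind U (thirdPt q r) := by
    rw [Finset.sum_comm]
    refine Finset.sum_congr rfl fun q _ => Finset.sum_congr rfl fun r _ => ?_
    rw [totDist_symm r q, thirdPt_comm r q]; ring
  have e2 : (∑ q : Pd d, ∑ r : Pd d, ind Y q * ind X r * (if TotDist q r = true then (1:ℤ) else 0) * ind U q) =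
      ∑ q : Pd d, ∑ r : Pd d, ind X q * ind Y r * (if TotDist q r = true then (1:ℤ) else 0) * ind U r := by
    rw [Finset.sum_comm]
    refine Finset.sum_congr rfl fun q _ => Finset.sum_congr rfl fun r _ => ?_
    rw [totDist_symm r q]; ring
  rw [e1, e2] at h
  exact h

/-- **THEOREM (Conjecture A at product test pairs; every `n, k`, every pair of blocks).**  `S ⊆ [3]^n`, `V ⊆ [3]^k` up-sets, `A = S × V`;
`d_S` with condition (N) for `S` and the box `d_S ≤ 2^{n+1}1_S`; `d_V` with condition (N) for `V` at the single rectangle `(X, Y)`; `F, G ⊆ [3]^n` and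
`X, Y ⊆ [3]^k` up-sets; `P = F × X`, `Q = G × Y`.  Then the co-count product satisfies (N) at `(P, Q)`:
`Σ_{x∈P, y∈Q} Θ_A(x,y) ≤ Σ_{x∈P∩Q} [2^{n+k+1}1_S1_V − (2^{n+1}1_S − d_S)(2^{k+1}1_V − d_V)](x)`. [this work] -/
theorem diagCert_coProduct_N_of_product (hA : ∀ ξ z, glue ξ z ∈ A ↔ (ξ ∈ S ∧ z ∈ V))
    (hS : IsUpperSet (S : Set (Pd n))) (hV : IsUpperSet (V : Set (Pd k)))
    (dS : Pd n → ℤ) (hmS : ∀ ξ : Pd n, dS ξ ≤ 2 * (2:ℤ) ^ n * ind S ξ)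
    (hNS : ∀ B B' : Finset (Pd n), IsUpperSet (B : Set (Pd n)) → IsUpperSet (B' : Set (Pd n)) →
      (∑ ξ ∈ B, ∑ η ∈ B', thetaVal S ξ η) ≤ ∑ ξ ∈ B ∩ B', dS ξ)
    (dV : Pd k → ℤ) {F G : Finset (Pd n)} {X Y : Finset (Pd k)}
    (hF : IsUpperSet (F : Set (Pd n))) (hG : IsUpperSet (G : Set (Pd n))) (hX : IsUpperSet (X : Set (Pd k))) (hY : IsUpperSet (Y : Set (Pd k)))
    (hNV : (∑ q ∈ X, ∑ r ∈ Y, thetaVal V q r) ≤ ∑ q ∈ X ∩ Y, dV q)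
    {P Q : Finset (Pd (n + k))} (hP : ∀ ξ q, glue ξ q ∈ P ↔ (ξ ∈ F ∧ q ∈ X)) (hQ : ∀ ξ q, glue ξ q ∈ Q ↔ (ξ ∈ G ∧ q ∈ Y)) :
    (∑ x ∈ P, ∑ y ∈ Q, thetaVal A x y) ≤ ∑ x ∈ P ∩ Q, (2 * (2:ℤ) ^ (n + k) * (ind S (freeOf x) * ind V (cellOf x))
        - (2 * (2:ℤ) ^ n * ind S (freeOf x) - dS (freeOf x)) * (2 * (2:ℤ) ^ k * ind V (cellOf x) - dV (cellOf x))) := by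
  -- names for the outer and inner counts
  set tS : Pd n → Pd n → ℤ := fun ξ η => if TotDist ξ η = true then (1:ℤ) else 0 with htS
  set tV : Pd k → Pd k → ℤ := fun q r => if TotDist q r = true then (1:ℤ) else 0 with htV
  set N1 : ℤ := ∑ ξ : Pd n, ∑ η : Pd n, ind F ξ * ind G η * tS ξ η * ind S ξ with hN1
  set N2 : ℤ := ∑ ξ : Pd n, ∑ η : Pd n, ind F ξ * ind G η * tS ξ η * ind S η with hN2
  set L : ℤ := ∑ ξ : Pd n, ∑ η : Pd n, ind F ξ * ind G η * tS ξ η * ind S (thirdPt ξ η) with hL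
  set a : ℤ := ∑ q : Pd k, ∑ r : Pd k, ind X q * ind Y r * tV q r * ind V q with ha
  set a' : ℤ := ∑ q : Pd k, ∑ r : Pd k, ind X q * ind Y r * tV q r * ind V r with ha'
  set m : ℤ := ∑ q : Pd k, ∑ r : Pd k, ind X q * ind Y r * tV q r * ind V (thirdPt q r) with hm
  set s : ℤ := ∑ ξ : Pd n, ind F ξ * ind G ξ * ind S ξ with hs
  set c : ℤ := ∑ ξ : Pd n, ind F ξ * ind G ξ * dS ξ with hc
  set nn : ℤ := ∑ q : Pd k, ind X q * ind Y q * ind V q with hnn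
  set yy : ℤ := ∑ q : Pd k, ind X q * ind Y q * dV q with hyy
  -- (1) the left side: Θ_A(P×Q) = N1·a + N2·a' − L·m
  have hL1 : (∑ x ∈ P, ∑ y ∈ Q, thetaVal A x y) = N1 * a + N2 * a' - L * m := by
    rw [theta_pairs_eq_sum4 (n := n) (k := k)]
    have hpt : ∀ (ξ : Pd n) (q : Pd k) (η : Pd n) (r : Pd k),
        ind P (glue ξ q) * ind Q (glue η r) * thetaVal A (glue ξ q) (glue η r) =
          (ind F ξ * ind G η * tS ξ η * ind S ξ) * (ind X q * ind Y r * tV q r * ind V q)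
          + (ind F ξ * ind G η * tS ξ η * ind S η) * (ind X q * ind Y r * tV q r * ind V r)
          - (ind F ξ * ind G η * tS ξ η * ind S (thirdPt ξ η)) * (ind X q * ind Y r * tV q r * ind V (thirdPt q r)) := by
      intro ξ q η r
      rw [ind_glue_product hP, ind_glue_product hQ, thetaVal_blockAnd hA]
      by_cases h1 : TotDist ξ η = true <;> by_cases h2 : TotDist q r = true <;> (simp [h1, h2, htS, htV]; try ring)
    rw [Finset.sum_congr rfl fun ξ _ => Finset.sum_congr rfl fun q _ => Finset.sum_congr rfl fun η _ =>
      Finset.sum_congr rfl fun r _ => hpt ξ q η r]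
    simp only [Finset.sum_sub_distrib, Finset.sum_add_distrib]
    rw [sum4_mul_eq, sum4_mul_eq, sum4_mul_eq]
  -- (2) the right side: d'(P∩Q) = 2·2^{n+k}·s·nn − (2·2^n s − c)(2·2^k nn − yy)
  have hR1 : (∑ x ∈ P ∩ Q, (2 * (2:ℤ) ^ (n + k) * (ind S (freeOf x) * ind V (cellOf x))
        - (2 * (2:ℤ) ^ n * ind S (freeOf x) - dS (freeOf x)) * (2 * (2:ℤ) ^ k * ind V (cellOf x) - dV (cellOf x)))) =
      2 * (2:ℤ) ^ (n + k) * (s * nn) - (2 * (2:ℤ) ^ n * s - c) * (2 * (2:ℤ) ^ k * nn - yy) := by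
    rw [sum_mem_eq_sum_ind_mul (P ∩ Q), sum_glue (n := n) (k := k)]
    have hpt : ∀ (ξ : Pd n) (q : Pd k), ind (P ∩ Q) (glue ξ q) * (2 * (2:ℤ) ^ (n + k) * (ind S (freeOf (glue ξ q)) * ind V (cellOf (glue ξ q)))
        - (2 * (2:ℤ) ^ n * ind S (freeOf (glue ξ q)) - dS (freeOf (glue ξ q))) * (2 * (2:ℤ) ^ k * ind V (cellOf (glue ξ q)) - dV (cellOf (glue ξ q)))) =
        2 * (2:ℤ) ^ (n + k) * ((ind F ξ * ind G ξ * ind S ξ) * (ind X q * ind Y q * ind V q))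
        - ((ind F ξ * ind G ξ * (2 * (2:ℤ) ^ n * ind S ξ - dS ξ)) * (ind X q * ind Y q * (2 * (2:ℤ) ^ k * ind V q - dV q))) := by
      intro ξ q
      rw [ind_inter_eq_mul, ind_glue_product hP, ind_glue_product hQ, freeOf_glue, cellOf_glue]
      have hF2 : ind F ξ * ind F ξ = ind F ξ := by unfold ind; split_ifs <;> ring
      have hG2 : ind G ξ * ind G ξ = ind G ξ := by unfold ind; split_ifs <;> ring
      have hX2 : ind X q * ind X q = ind X q := by unfold ind; split_ifs <;> ring
      have hY2 : ind Y q * ind Y q = ind Y q := by unfold ind; split_ifs <;> ring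
      have e : ind F ξ * ind X q * (ind G ξ * ind Y q) = (ind F ξ * ind G ξ) * (ind X q * ind Y q) := by ring
      rw [e]; ring
    rw [Finset.sum_congr rfl fun ξ _ => Finset.sum_congr rfl fun q _ => hpt ξ q, sum2_linComb]
    have hsS : (∑ ξ : Pd n, ind F ξ * ind G ξ * (2 * (2:ℤ) ^ n * ind S ξ - dS ξ)) = 2 * (2:ℤ) ^ n * s - c := by
      rw [hs, hc, Finset.mul_sum, ← Finset.sum_sub_distrib]
      refine Finset.sum_congr rfl fun ξ _ => ?_; ring
    have hsV : (∑ q : Pd k, ind X q * ind Y q * (2 * (2:ℤ) ^ k * ind V q - dV q)) = 2 * (2:ℤ) ^ k * nn - yy := by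
      rw [hnn, hyy, Finset.mul_sum, ← Finset.sum_sub_distrib]
      refine Finset.sum_congr rfl fun q _ => ?_; ring
    rw [hsS, hsV]
  -- (3) the inequalities
  -- (N_S) at (F,G): Θ_S(F×G) = N1 + N2 − L ≤ c
  have hΘS : N1 + N2 - L ≤ c := by
    have h := hNS F G hF hG
    rw [theta_rect_eq_counts S F G] at h
    have e : (∑ ξ ∈ F ∩ G, dS ξ) = c := by
      rw [hc, sum_mem_eq_sum_ind_mul (F ∩ G)]
      refine Finset.sum_congr rfl fun ξ _ => ?_
      rw [ind_inter_eq_mul]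
    rw [e] at h
    exact h
  -- (N_V) at (X,Y): a + a' − m ≤ yy
  have hΘV : a + a' - m ≤ yy := by
    have h := hNV
    rw [theta_rect_eq_counts V X Y] at h
    have e : (∑ q ∈ X ∩ Y, dV q) = yy := by
      rw [hyy, sum_mem_eq_sum_ind_mul (X ∩ Y)]
      refine Finset.sum_congr rfl fun q _ => ?_
      rw [ind_inter_eq_mul]
    rw [e] at h
    exact h
  -- Harris (outer and inner)
  have hH1 : N1 ≤ 2 ^ n * s := pairCount_le_harris hS hF hG
  have hH2 : N2 ≤ 2 ^ n * s := pairCount_le_harris' hS hF hG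
  have hH3 : a ≤ 2 ^ k * nn := pairCount_le_harris hV hX hY
  have hH4 : a' ≤ 2 ^ k * nn := pairCount_le_harris' hV hX hY
  -- Kleitman (inner)
  have hK1 : m ≤ a := latCount_le_pairCount hV hX
  have hK2 : m ≤ a' := latCount_le_pairCount' hV hY
  have hm0 : 0 ≤ m := by
    rw [hm]
    refine Finset.sum_nonneg fun q _ => Finset.sum_nonneg fun r _ => ?_
    have htv : 0 ≤ tV q r := by simp only [htV]; split_ifs <;> norm_num
    exact mul_nonneg (mul_nonneg (mul_nonneg (ind_nonneg' X q) (ind_nonneg' Y r)) htv) (ind_nonneg' V (thirdPt q r))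
  -- box of d_S on F∩G: c ≤ 2·2^n·s
  have hbox : c ≤ 2 * (2:ℤ) ^ n * s := by
    rw [hc, hs, Finset.mul_sum]
    refine Finset.sum_le_sum fun ξ _ => ?_
    have h1 := hmS ξ
    have hFG : 0 ≤ ind F ξ * ind G ξ := mul_nonneg (ind_nonneg' F ξ) (ind_nonneg' G ξ)
    have h2 := mul_le_mul_of_nonneg_left h1 hFG
    linarith [h2]
  -- lower bound 2^n s ≤ c from (N_S) at (⊤, F∩G)
  have hlow : 2 ^ n * s ≤ c := by
    have h := diagCert_lower_of_N S dS hNS (F ∩ G) (isUpperSet_inter_coe hF hG)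
    have e1 : (((S ∩ (F ∩ G) : Finset (Pd n)).card : ℤ)) = s := by
      rw [hs, ← sum_ind_eq_card_inter S (F ∩ G), sum_mem_eq_sum_ind_mul (F ∩ G)]
      refine Finset.sum_congr rfl fun ξ _ => ?_
      rw [ind_inter_eq_mul]
    have e2 : (∑ ξ ∈ F ∩ G, dS ξ) = c := by
      rw [hc, sum_mem_eq_sum_ind_mul (F ∩ G)]
      refine Finset.sum_congr rfl fun ξ _ => ?_
      rw [ind_inter_eq_mul]
    rw [e1, e2] at h
    exact h
  -- (4) conclusion: the difference is a sum of five nonnegative products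
  rw [hL1, hR1, pow_add]
  nlinarith [mul_nonneg (sub_nonneg.2 hbox) (sub_nonneg.2 hΘV), mul_nonneg hm0 (sub_nonneg.2 hΘS),
    mul_nonneg (sub_nonneg.2 hK1) (sub_nonneg.2 hH1), mul_nonneg (sub_nonneg.2 hK2) (sub_nonneg.2 hH2),
    mul_nonneg (sub_nonneg.2 hlow) (sub_nonneg.2 hH3), mul_nonneg (sub_nonneg.2 hlow) (sub_nonneg.2 hH4)]

end Summit.CriticalPhenomena.PercolationContinuityZ3.Theorems.SahiGridPattern
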